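import Summits.Ventures.LatticeQCDFlow.Scaling.DoeblinHotSampler
import Summits.Ventures.LatticeQCDFlow.Scaling.WarmStartCeiling

/-!
HONEST FRAMING: exact (Metropolis-corrected) sampling algorithms for lattice gauge theory; figures
of merit are autocorrelation/cost numbers at stated couplings and volumes; no continuum-physics
claim.

# DoeblinHotWarmStart — RE-EQUILIBRATION AFTER PERTURBING THE REPLICAS IN `D₀` COSTS `(2m/(tcp))·log((2j+p)/(pε))`,
# `j = #(D₀∖{0})`, ALSO WHEN THE HOT LEVEL IS ONLY A DOEBLIN-MINORISED STATIONARY SAMPLER — ONCE `4t ≤ p(1−t)·a·w_0`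
# (lean-2 GEN-27, ours)

Venture-side (OURS).  Cell `lqcd-flow` (pub-lqcd), unit `pub-lqcd-lean-2-g27`, 2026-08-27.  Doeblin-minorised hot
samplers, file 8.  Settings of `Scaling/DoeblinHotMixingCeiling` (partly refreshed hub: exact refresh of weight `w_E`,
`μ_k`-stationary moves at every level) and `Scaling/DoeblinHotSampler` (`μ_0`-stationary hot kernel with
`M_0(u,·) ≥ a·μ_0(·)`); the PINNED START of `Scaling/WarmStartCeiling`: replicas `j ∈ D₀` at `x_j`, the others exactly
`μ_j`-distributed (`λ₀ = ⊗_j g_j`, `g_j = δ_{x_j}` on `D₀`, `μ_j` off `D₀`).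

## What is proved

* **`refreshWarmStart_tvDist_le_stale`** — `‖λ₀Pⁿ − π̃‖_TV ≤ Σ_{D≠∅}(δ_{D₀}Qⁿ)(D)` for the partly refreshed hub, `Q`
  chapter M's tag chain with hot weight `w_E`; **`refreshWarmStart_tvDist_le`** — one-sided domination and
  `4t ≤ p(1−t)w_E`: `‖λ₀Pⁿ − π̃‖_TV ≤ ((2·#(D₀∖{0}) + p·𝟙{0∈D₀})/p)·(1 − tcp/(2m))ⁿ`.
* **`doeblinWarmStart_tvDist_le`** — the same bound for chapter M's scheme with a Doeblin-minorised hot sampler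
  (`4t ≤ p(1−t)·a·w_0`); **`doeblinWarmStart_tvDist_le_of_ge_log`** — `≤ ε` once
  `n ≥ (2m/(tcp))·log((2·#(D₀∖{0}) + p·𝟙{0∈D₀})/(pε))` (`D₀ ≠ ∅`).

Reading (no numerics implied): after a local perturbation of an equilibrated flow-assisted ladder whose hot level
is a Metropolised flow with acceptance floor `a`, the re-equilibration time is logarithmic in the NUMBER OF PERTURBED
REPLICAS, not in `K`, exactly as with an exact hot sampler (`Scaling/WarmStartCeiling`).  NOT CLAIMED: anything
without the minorisation; anything measured.  Literature grade (cell rule): OWN RESULT; nothing cited as a fact; no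
new bib keys.
-/

noncomputable section

open Finset Function
open Literature.Probability.MarkovChains

namespace Summit.Ventures.LatticeQCDFlow.Scaling

variable {S : Type*} [Fintype S] [DecidableEq S] {K m : ℕ} {μ : Fin (K + 1) → S → ℝ} {M E : Fin (K + 1) → S → S → ℝ}
  {w : Fin (K + 1) → ℝ} {t wE p q a : ℝ}

section Warm
variable (κ : Fin m → Fin K) (φ : Fin m → Equiv.Perm S)

/-- **THE WARM-START FRESHNESS BOUND FOR THE PARTLY REFRESHED HUB: `‖λ₀Pⁿ − π̃‖_TV ≤ Σ_{D≠∅}(δ_{D₀}Qⁿ)(D)`** (pinned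
start on `D₀`; two one-sided constants `0 ≤ p, q ≤ 1`; `Q` the tag chain of hot weight `w_E`). [ours] -/
theorem refreshWarmStart_tvDist_le_stale (hm : 1 ≤ m) (ht0 : 0 ≤ t) (ht1 : t ≤ 1) (hwE0 : 0 ≤ wE) (hw0 : ∀ k, 0 ≤ w k)
    (hw1 : wE + ∑ k, w k = 1) (hμ : ∀ k x, 0 < μ k x) (hμ1 : ∀ k, ∑ u, μ k u = 1) (hM : ∀ k, IsRowStochastic (M k))
    (hE : ∀ k u v, E k u v = μ k v) (hstat : ∀ (k : Fin (K + 1)) (v : S), ∑ u, μ k u * M k u v = μ k v)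
    (hp0 : 0 ≤ p) (hp1 : p ≤ 1) (hq0 : 0 ≤ q) (hq1 : q ≤ 1) (hdom : ∀ r u, p * μ (κ r).succ (φ r u) ≤ μ 0 u)
    (hrev : ∀ r u, q * μ 0 u ≤ μ (κ r).succ (φ r u))
    {gbar : Fin m → Finset (Fin (K + 1)) → ℝ}
    (hg : ∀ r D, gbar r D = if (0 : Fin (K + 1)) ∉ D then (if (κ r).succ ∉ D then (1 : ℝ) else p)
      else (if (κ r).succ ∉ D then q else 0))
    {Bset : Fin m → Finset (Fin (K + 1)) → Finset (Fin (K + 1))}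
    (hB : ∀ r D, Bset r D = if (0 : Fin (K + 1)) ∉ D ∧ (κ r).succ ∉ D then D
      else insert (0 : Fin (K + 1)) (insert (κ r).succ D))
    {Q : Finset (Fin (K + 1)) → Finset (Fin (K + 1)) → ℝ}
    (hQ : ∀ D D', Q D D' = ∑ r : Fin m, t / m *
        (gbar r D * (if D' = D.image (Equiv.swap (0 : Fin (K + 1)) (κ r).succ) then (1 : ℝ) else 0)
          + (1 - gbar r D) * (if D' = Bset r D then (1 : ℝ) else 0))
      + (1 - t) * (wE * (if D' = D.erase 0 then (1 : ℝ) else 0) + (1 - wE) * (if D' = D then (1 : ℝ) else 0)))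
    (D₀ : Finset (Fin (K + 1))) (x : Fin (K + 1) → S)
    {g : Fin (K + 1) → S → ℝ} (hg' : ∀ j u, g j u = if j ∈ D₀ then (if u = x j then (1 : ℝ) else 0) else μ j u)
    (n : ℕ) :
    tvDist (lawAt (fun y z : Fin (K + 1) → S =>
          t * ptGraphSwap μ (fun r : Fin m => (((0 : Fin (K + 1)), (κ r).succ) : Fin (K + 1) × Fin (K + 1))) φ y z
          + (1 - t) * (wE * coordKernel E 0 y z + prodKernel w M y z)) (tensorFun g) n) (tensorFun μ)
      ≤ ∑ D ∈ univ.filter (fun D : Finset (Fin (K + 1)) => D ≠ ∅), lawAt Q (Pi.single D₀ 1) n D := by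
  -- the hypothesis-equation objects of the augmentation
  set α : Fin m → (Fin (K + 1) → S) → ℝ :=
    fun r z => min 1 (tensorFun μ (edgeFlowSwap (φ r) 0 (κ r).succ z) / tensorFun μ z) with hα_def
  have hα : ∀ r z, α r z = min 1 (tensorFun μ (edgeFlowSwap (φ r) 0 (κ r).succ z) / tensorFun μ z) := fun _ _ => rfl
  set β : Fin m → (Fin (K + 1) → S) → ℝ := fun r z => p * μ (κ r).succ (φ r (z 0)) / μ 0 (z 0) with hβ_def
  have hβ : ∀ r z, β r z = p * μ (κ r).succ (φ r (z 0)) / μ 0 (z 0) := fun _ _ => rfl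
  set β' : Fin m → (Fin (K + 1) → S) → ℝ :=
    fun r z => q * μ 0 ((φ r).symm (z (κ r).succ)) / μ (κ r).succ (z (κ r).succ) with hβ'_def
  have hβ' : ∀ r z, β' r z = q * μ 0 ((φ r).symm (z (κ r).succ)) / μ (κ r).succ (z (κ r).succ) := fun _ _ => rfl
  set γ : Fin m → (Fin (K + 1) → S) × Finset (Fin (K + 1)) → ℝ := fun r a =>
    if (0 : Fin (K + 1)) ∉ a.2 then (if (κ r).succ ∉ a.2 then α r a.1 else β r a.1)
    else (if (κ r).succ ∉ a.2 then β' r a.1 else 0) with hγ_def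
  have hγ : ∀ r a, γ r a = if (0 : Fin (K + 1)) ∉ a.2 then (if (κ r).succ ∉ a.2 then α r a.1 else β r a.1)
      else (if (κ r).succ ∉ a.2 then β' r a.1 else 0) := fun _ _ => rfl
  set Ph : (Fin (K + 1) → S) × Finset (Fin (K + 1)) → (Fin (K + 1) → S) × Finset (Fin (K + 1)) → ℝ := fun a b =>
    ∑ r : Fin m, t / m *
        (γ r a * (if b.1 = edgeFlowSwap (φ r) 0 (κ r).succ a.1 ∧ b.2 = a.2.image (Equiv.swap (0 : Fin (K + 1)) (κ r).succ)
            then (1 : ℝ) else 0)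
          + (α r a.1 - γ r a) * (if b.1 = edgeFlowSwap (φ r) 0 (κ r).succ a.1 ∧ b.2 = Bset r a.2 then (1 : ℝ) else 0)
          + (1 - α r a.1) * (if b.1 = a.1 ∧ b.2 = Bset r a.2 then (1 : ℝ) else 0))
      + (1 - t) * (wE * (coordKernel E 0 a.1 b.1 * (if b.2 = a.2.erase 0 then (1 : ℝ) else 0))
          + ∑ k : Fin (K + 1), w k * (coordKernel M k a.1 b.1 * (if b.2 = a.2 then (1 : ℝ) else 0))) with hPh_def
  have hPh : ∀ a b, Ph a b = ∑ r : Fin m, t / m *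
        (γ r a * (if b.1 = edgeFlowSwap (φ r) 0 (κ r).succ a.1 ∧ b.2 = a.2.image (Equiv.swap (0 : Fin (K + 1)) (κ r).succ)
            then (1 : ℝ) else 0)
          + (α r a.1 - γ r a) * (if b.1 = edgeFlowSwap (φ r) 0 (κ r).succ a.1 ∧ b.2 = Bset r a.2 then (1 : ℝ) else 0)
          + (1 - α r a.1) * (if b.1 = a.1 ∧ b.2 = Bset r a.2 then (1 : ℝ) else 0))
      + (1 - t) * (wE * (coordKernel E 0 a.1 b.1 * (if b.2 = a.2.erase 0 then (1 : ℝ) else 0))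
          + ∑ k : Fin (K + 1), w k * (coordKernel M k a.1 b.1 * (if b.2 = a.2 then (1 : ℝ) else 0))) := fun _ _ => rfl
  set Λ₀ : (Fin (K + 1) → S) × Finset (Fin (K + 1)) → ℝ := fun a => (if a.2 = D₀ then (1 : ℝ) else 0) * tensorFun g a.1
    with hΛ_def
  have hΛ : ∀ a, Λ₀ a = (if a.2 = D₀ then (1 : ℝ) else 0) * tensorFun g a.1 := fun _ => rfl
  have hfresh := pinnedAug_fresh (μ := μ) D₀ x hg' hΛ
  have hΛ0 : ∀ a, 0 ≤ Λ₀ a := fun a => by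
    rw [hΛ]; exact mul_nonneg (by split_ifs <;> norm_num) (pinnedLaw_nonneg hμ D₀ x hg' a.1)
  have hΛ1 : ∑ a, Λ₀ a = 1 := by
    rw [Fintype.sum_prod_type_right]
    simp_rw [pinnedAug_snd hμ1 D₀ x hg' hΛ]
    rw [Finset.sum_pi_single', if_pos (mem_univ _)]
  have h := dob_tvDist_le_stale_of κ φ hm ht0 ht1 hwE0 hw0 hw1 hμ hμ1 hM hE hstat hp0 hp1 hq0 hq1 hdom hrev hα hβ hβ' hγ
    hg hB hPh hQ hfresh hΛ0 hΛ1 n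
  have hfst : (fun z' => ∑ D, Λ₀ (z', D)) = tensorFun g := funext fun z' => pinnedAug_fst D₀ hΛ z'
  have hsnd : (fun D' => ∑ z : Fin (K + 1) → S, Λ₀ (z, D')) = (Pi.single D₀ (1 : ℝ) : Finset (Fin (K + 1)) → ℝ) :=
    funext fun D' => pinnedAug_snd hμ1 D₀ x hg' hΛ D'
  rw [hfst, hsnd] at h
  exact h

/-- **THE WARM-START CEILING FOR THE PARTLY REFRESHED HUB:** one-sided domination (`0 < p ≤ 1`), `4t ≤ p(1−t)w_E`,
pinned start on `D₀`: **`‖λ₀Pⁿ − π̃‖_TV ≤ ((2·#(D₀∖{0}) + p·𝟙{0 ∈ D₀})/p)·(1 − tcp/(2m))ⁿ`.** [ours] -/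
theorem refreshWarmStart_tvDist_le (hm : 1 ≤ m) (ht0 : 0 ≤ t) (ht1 : t ≤ 1) (hwE0 : 0 ≤ wE) (hw0 : ∀ k, 0 ≤ w k)
    (hw1 : wE + ∑ k, w k = 1) (hμ : ∀ k x, 0 < μ k x) (hμ1 : ∀ k, ∑ u, μ k u = 1) (hM : ∀ k, IsRowStochastic (M k))
    (hE : ∀ k u v, E k u v = μ k v) (hstat : ∀ (k : Fin (K + 1)) (v : S), ∑ u, μ k u * M k u v = μ k v)
    (hp0 : 0 < p) (hp1 : p ≤ 1) (hdom : ∀ r u, p * μ (κ r).succ (φ r u) ≤ μ 0 u) (hreg : 4 * t ≤ p * (1 - t) * wE)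
    {c : ℕ} (hc1 : 1 ≤ c) (hc : ∀ p' : Fin K, c ≤ (univ.filter (fun r : Fin m => κ r = p')).card) (hcm : c ≤ m)
    (D₀ : Finset (Fin (K + 1))) (x : Fin (K + 1) → S)
    {g : Fin (K + 1) → S → ℝ} (hg' : ∀ j u, g j u = if j ∈ D₀ then (if u = x j then (1 : ℝ) else 0) else μ j u)
    (n : ℕ) :
    tvDist (lawAt (fun y z : Fin (K + 1) → S =>
          t * ptGraphSwap μ (fun r : Fin m => (((0 : Fin (K + 1)), (κ r).succ) : Fin (K + 1) × Fin (K + 1))) φ y z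
          + (1 - t) * (wE * coordKernel E 0 y z + prodKernel w M y z)) (tensorFun g) n) (tensorFun μ)
      ≤ (2 * ((D₀.erase 0).card : ℝ) + p * (if (0 : Fin (K + 1)) ∈ D₀ then (1 : ℝ) else 0)) / p
          * (1 - t * c * p / (2 * m)) ^ n := by
  set gbar : Fin m → Finset (Fin (K + 1)) → ℝ := fun r D =>
    if (0 : Fin (K + 1)) ∉ D then (if (κ r).succ ∉ D then (1 : ℝ) else p) else (if (κ r).succ ∉ D then (0 : ℝ) else 0)
    with hg_def
  have hg : ∀ r D, gbar r D = if (0 : Fin (K + 1)) ∉ D then (if (κ r).succ ∉ D then (1 : ℝ) else p)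
      else (if (κ r).succ ∉ D then (0 : ℝ) else 0) := fun _ _ => rfl
  set Bset : Fin m → Finset (Fin (K + 1)) → Finset (Fin (K + 1)) := fun r D =>
    if (0 : Fin (K + 1)) ∉ D ∧ (κ r).succ ∉ D then D else insert (0 : Fin (K + 1)) (insert (κ r).succ D) with hB_def
  have hB : ∀ r D, Bset r D = if (0 : Fin (K + 1)) ∉ D ∧ (κ r).succ ∉ D then D
      else insert (0 : Fin (K + 1)) (insert (κ r).succ D) := fun _ _ => rfl
  set Q : Finset (Fin (K + 1)) → Finset (Fin (K + 1)) → ℝ := fun D D' => ∑ r : Fin m, t / m *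
        (gbar r D * (if D' = D.image (Equiv.swap (0 : Fin (K + 1)) (κ r).succ) then (1 : ℝ) else 0)
          + (1 - gbar r D) * (if D' = Bset r D then (1 : ℝ) else 0))
      + (1 - t) * (wE * (if D' = D.erase 0 then (1 : ℝ) else 0) + (1 - wE) * (if D' = D then (1 : ℝ) else 0)) with hQ_def
  have hQ : ∀ D D', Q D D' = ∑ r : Fin m, t / m *
        (gbar r D * (if D' = D.image (Equiv.swap (0 : Fin (K + 1)) (κ r).succ) then (1 : ℝ) else 0)
          + (1 - gbar r D) * (if D' = Bset r D then (1 : ℝ) else 0))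
      + (1 - t) * ((fun _ : Fin (K + 1) => wE) 0 * (if D' = D.erase 0 then (1 : ℝ) else 0)
          + (1 - (fun _ : Fin (K + 1) => wE) 0) * (if D' = D then (1 : ℝ) else 0)) := fun _ _ => rfl
  have hwE1 : wE ≤ 1 := by
    have h := sum_nonneg fun k (_ : k ∈ (univ : Finset (Fin (K + 1)))) => hw0 k
    linarith
  have hrev : ∀ r u, (0 : ℝ) * μ 0 u ≤ μ (κ r).succ (φ r u) := fun r u => by rw [zero_mul]; exact (hμ _ _).le
  have hstale := refreshWarmStart_tvDist_le_stale κ φ hm ht0 ht1 hwE0 hw0 hw1 hμ hμ1 hM hE hstat hp0.le hp1 le_rfl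
    zero_le_one hdom hrev hg hB (fun _ _ => rfl) D₀ x hg' n
  -- the three drift conditions at `b = p/2`, `ρ = tcp/(2m)`, `q = 0`, hot weight `w_E`
  have hmpos : (0 : ℝ) < m := Nat.cast_pos.mpr (by omega)
  have hcpos : (0 : ℝ) < c := Nat.cast_pos.mpr (by omega)
  have hcm' : (c : ℝ) ≤ m := by exact_mod_cast hcm
  have hρt : t * c * p / (2 * m) ≤ t / 2 := by
    have : t * c * p / (2 * m) = t / 2 * (c / m) * p := by field_simp
    rw [this]
    have hcm1 : (c : ℝ) / m ≤ 1 := (div_le_one hmpos).mpr hcm'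
    calc t / 2 * (c / m) * p ≤ t / 2 * 1 * 1 := by gcongr
      _ = t / 2 := by ring
  have hρ1 : t * c * p / (2 * m) ≤ 1 := by linarith
  have h1 : t * c * p / (2 * m) ≤ t * c * (p - p / 2) / m := by apply le_of_eq; field_simp; ring
  have h2 : t * c * p / (2 * m) * (p / 2) ≤ (1 - t) * (fun _ : Fin (K + 1) => wE) 0 * (p / 2) - t * (1 - 0 * (p / 2)) := by
    show t * c * p / (2 * m) * (p / 2) ≤ (1 - t) * wE * (p / 2) - t * (1 - 0 * (p / 2))
    nlinarith [hρt, hp1, hp0]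
  have h3 : t * c * p / (2 * m) ≤ t * (1 - 0 * (p / 2)) * c / m := by
    rw [zero_mul, sub_zero]
    have : t * c * p / (2 * m) = t * (p / 2) * c / m := by field_simp
    rw [this]
    gcongr
    linarith
  have htag := regen_nonempty_le_from κ (w := fun _ : Fin (K + 1) => wE) hm ht0 ht1 hwE0 hwE1 hp1 le_rfl zero_le_one hg
    hB hQ hc (by positivity : 0 < p / 2) (by linarith : p / 2 ≤ p) hρ1 h1 h2 h3 D₀ n
  have hΦ : ∑ k ∈ D₀, (if k = (0 : Fin (K + 1)) then p / 2 else (1 : ℝ))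
      = ((D₀.erase 0).card : ℝ) + p / 2 * (if (0 : Fin (K + 1)) ∈ D₀ then (1 : ℝ) else 0) := by
    by_cases h0 : (0 : Fin (K + 1)) ∈ D₀
    · rw [← Finset.insert_erase h0, Finset.sum_insert (Finset.notMem_erase 0 D₀), if_pos rfl, Finset.erase_insert
        (Finset.notMem_erase 0 D₀), if_pos (Finset.mem_insert_self _ _)]
      rw [Finset.sum_congr rfl fun k hk => if_neg (Finset.ne_of_mem_erase hk), sum_const, nsmul_eq_mul, mul_one]
      ring
    · rw [if_neg h0, mul_zero, add_zero, Finset.erase_eq_of_notMem h0,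
        Finset.sum_congr rfl fun k hk => if_neg (fun h => h0 (by rw [h] at hk; exact hk)), sum_const, nsmul_eq_mul,
        mul_one]
  rw [hΦ] at htag
  refine hstale.trans (htag.trans (le_of_eq ?_))
  field_simp

/-- **THE WARM-START CEILING WITH A DOEBLIN-MINORISED HOT SAMPLER:** `μ_k`-stationary kernels, `M_0(u,·) ≥ a·μ_0`
(`0 < a ≤ 1`), one-sided domination (`0 < p ≤ 1`), `4t ≤ p(1−t)·a·w_0`, pinned start on `D₀`:
**`‖λ₀Pⁿ − π̃‖_TV ≤ ((2·#(D₀∖{0}) + p·𝟙{0 ∈ D₀})/p)·(1 − tcp/(2m))ⁿ`.** [ours] -/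
theorem doeblinWarmStart_tvDist_le (hm : 1 ≤ m) (ht0 : 0 ≤ t) (ht1 : t ≤ 1) (hw0 : ∀ k, 0 ≤ w k) (hw1 : ∑ k, w k = 1)
    (hμ : ∀ k x, 0 < μ k x) (hμ1 : ∀ k, ∑ u, μ k u = 1) (hM : ∀ k, IsRowStochastic (M k))
    (hstat : ∀ (k : Fin (K + 1)) (v : S), ∑ u, μ k u * M k u v = μ k v) (ha0 : 0 < a) (ha1 : a ≤ 1)
    (hmin : ∀ u v, a * μ 0 v ≤ M 0 u v)
    (hp0 : 0 < p) (hp1 : p ≤ 1) (hdom : ∀ r u, p * μ (κ r).succ (φ r u) ≤ μ 0 u)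
    (hreg : 4 * t ≤ p * (1 - t) * (a * w 0))
    {c : ℕ} (hc1 : 1 ≤ c) (hc : ∀ p' : Fin K, c ≤ (univ.filter (fun r : Fin m => κ r = p')).card) (hcm : c ≤ m)
    (D₀ : Finset (Fin (K + 1))) (x : Fin (K + 1) → S)
    {g : Fin (K + 1) → S → ℝ} (hg' : ∀ j u, g j u = if j ∈ D₀ then (if u = x j then (1 : ℝ) else 0) else μ j u)
    (n : ℕ) :
    tvDist (lawAt (fun y z : Fin (K + 1) → S =>
          t * ptGraphSwap μ (fun r : Fin m => (((0 : Fin (K + 1)), (κ r).succ) : Fin (K + 1) × Fin (K + 1))) φ y z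
          + (1 - t) * prodKernel w M y z) (tensorFun g) n) (tensorFun μ)
      ≤ (2 * ((D₀.erase 0).card : ℝ) + p * (if (0 : Fin (K + 1)) ∈ D₀ then (1 : ℝ) else 0)) / p
          * (1 - t * c * p / (2 * m)) ^ n := by
  set R : S → S → ℝ := fun u v => if a < 1 then (M 0 u v - a * μ 0 v) / (1 - a) else μ 0 v with hR_def
  have hR : ∀ u v, R u v = if a < 1 then (M 0 u v - a * μ 0 v) / (1 - a) else μ 0 v := fun _ _ => rfl
  set E : Fin (K + 1) → S → S → ℝ := fun k _ v => μ k v with hE_def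
  have hE : ∀ k u v, E k u v = μ k v := fun _ _ _ => rfl
  set N : Fin (K + 1) → S → S → ℝ := fun k u v => if k = 0 then R u v else M k u v with hN_def
  have hN : ∀ k u v, N k u v = if k = 0 then R u v else M k u v := fun _ _ _ => rfl
  set w' : Fin (K + 1) → ℝ := fun k => if k = 0 then (1 - a) * w 0 else w k with hw'_def
  have hw' : ∀ k, w' k = if k = 0 then (1 - a) * w 0 else w k := fun _ => rfl
  obtain ⟨hsplit, hNrs, hNst⟩ := doeblin_residualFamily hM hμ hμ1 hstat ha1 hmin hR hN
  obtain ⟨hw'0, hw'1⟩ := doeblin_weights ha1 hw0 hw1 hw'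
  rw [doeblin_scheme_eq κ φ hsplit hE hN hw']
  exact refreshWarmStart_tvDist_le κ φ hm ht0 ht1 (mul_nonneg ha0.le (hw0 0)) hw'0 hw'1 hμ hμ1 hNrs hE hNst hp0 hp1 hdom
    hreg hc1 hc hcm D₀ x hg' n

/-- **THE WARM-START TIME WITH A DOEBLIN-MINORISED HOT SAMPLER: `‖λ₀Pⁿ − π̃‖_TV ≤ ε` ONCE
`n ≥ (2m/(tcp))·log((2·#(D₀∖{0}) + p·𝟙{0∈D₀})/(pε))`** (`0 < t`, `D₀` non-empty). [ours] -/
theorem doeblinWarmStart_tvDist_le_of_ge_log (hm : 1 ≤ m) (ht0 : 0 < t) (ht1 : t ≤ 1) (hw0 : ∀ k, 0 ≤ w k)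
    (hw1 : ∑ k, w k = 1) (hμ : ∀ k x, 0 < μ k x) (hμ1 : ∀ k, ∑ u, μ k u = 1) (hM : ∀ k, IsRowStochastic (M k))
    (hstat : ∀ (k : Fin (K + 1)) (v : S), ∑ u, μ k u * M k u v = μ k v) (ha0 : 0 < a) (ha1 : a ≤ 1)
    (hmin : ∀ u v, a * μ 0 v ≤ M 0 u v)
    (hp0 : 0 < p) (hp1 : p ≤ 1) (hdom : ∀ r u, p * μ (κ r).succ (φ r u) ≤ μ 0 u)
    (hreg : 4 * t ≤ p * (1 - t) * (a * w 0))
    {c : ℕ} (hc1 : 1 ≤ c) (hc : ∀ p' : Fin K, c ≤ (univ.filter (fun r : Fin m => κ r = p')).card) (hcm : c ≤ m)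
    (D₀ : Finset (Fin (K + 1))) (hD₀ : D₀.Nonempty) (x : Fin (K + 1) → S)
    {g : Fin (K + 1) → S → ℝ} (hg' : ∀ j u, g j u = if j ∈ D₀ then (if u = x j then (1 : ℝ) else 0) else μ j u)
    {ε : ℝ} (hε : 0 < ε) {n : ℕ}
    (hn : 2 * (m : ℝ) / (t * c * p)
      * Real.log ((2 * ((D₀.erase 0).card : ℝ) + p * (if (0 : Fin (K + 1)) ∈ D₀ then (1 : ℝ) else 0)) / (p * ε)) ≤ n) :
    tvDist (lawAt (fun y z : Fin (K + 1) → S =>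
          t * ptGraphSwap μ (fun r : Fin m => (((0 : Fin (K + 1)), (κ r).succ) : Fin (K + 1) × Fin (K + 1))) φ y z
          + (1 - t) * prodKernel w M y z) (tensorFun g) n) (tensorFun μ) ≤ ε := by
  have hmpos : (0 : ℝ) < m := Nat.cast_pos.mpr (by omega)
  have hcpos : (0 : ℝ) < c := Nat.cast_pos.mpr (by omega)
  have hcm' : (c : ℝ) ≤ m := by exact_mod_cast hcm
  refine (doeblinWarmStart_tvDist_le κ φ hm ht0.le ht1 hw0 hw1 hμ hμ1 hM hstat ha0 ha1 hmin hp0 hp1 hdom hreg hc1 hc hcm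
    D₀ x hg' n).trans ?_
  have hq0 : 0 < t * c * p / (2 * m) := by positivity
  have hq1 : t * c * p / (2 * m) ≤ 1 := by
    rw [div_le_one (by positivity)]
    have h1 : t * c ≤ 1 * m := by nlinarith
    nlinarith
  have hC : 0 < (2 * ((D₀.erase 0).card : ℝ) + p * (if (0 : Fin (K + 1)) ∈ D₀ then (1 : ℝ) else 0)) / p := by
    refine div_pos ?_ hp0
    by_cases h0 : (0 : Fin (K + 1)) ∈ D₀
    · rw [if_pos h0, mul_one]; positivity
    · rw [if_neg h0, mul_zero, add_zero]
      obtain ⟨k, hk⟩ := hD₀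
      have hk' : k ∈ D₀.erase 0 := Finset.mem_erase.mpr ⟨fun h => h0 (h ▸ hk), hk⟩
      have : 0 < ((D₀.erase 0).card : ℝ) := by exact_mod_cast Finset.card_pos.mpr ⟨k, hk'⟩
      linarith
  refine geom_le_of_ge_log hq0 hq1 hC hε ?_
  have e1 : 1 / (t * c * p / (2 * m)) = 2 * (m : ℝ) / (t * c * p) := by field_simp
  have e2 : (2 * ((D₀.erase 0).card : ℝ) + p * (if (0 : Fin (K + 1)) ∈ D₀ then (1 : ℝ) else 0)) / p / ε
      = (2 * ((D₀.erase 0).card : ℝ) + p * (if (0 : Fin (K + 1)) ∈ D₀ then (1 : ℝ) else 0)) / (p * ε) := by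
    rw [div_div]
  rw [e1, e2]; exact hn

end Warm

end Summit.Ventures.LatticeQCDFlow.Scaling

end
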